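import Summits.HubbardSuperconductivity.HubbardSuperconductivity.Theorems.ThermalWedgeTwTipContinuationEdgeOrder
import Summits.HubbardSuperconductivity.HubbardSuperconductivity.Theorems.TwTipContinuation.Negative.TipNormalForm
import Literature.MathematicalPhysics.QuantumLattice.HubbardGrandCanonicalDensity

/-!
# Route `ThermalWedge` — the ANCHOR `TwSeededRung` (stmt-HubbardSuperconductivity-1699) holds
# unconditionally down to seeds `g ≥ B/log(A/U)`; its constructive content is the sliver `[K·U, B/log(A/U))`

`--supports stmt-HubbardSuperconductivity-1699`; no definitions. `H_L(U,g) := hubbardTorus 2 L 1 U − (g/L²)P_L`,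
`P_L := (pairField d L)ᴴ(pairField d L)`, `E_L(U,g) := minEnergyOn (H_L(U,g)) (szSector (2n_L) 0)`,
`n_L = ⌊(1−δ)L²/2⌋`. The anchor asks every-ground-state `d`-wave order `c L⁴ ≤ re⟨ψ,P_Lψ⟩` of `H_L(U,g)`
for all seeds `g ∈ [K·U, 1/10]`; the tree has it SOFTLY on every `U`-independent band `[g₀, 1/10]`
(`AnchorDischarge.anchorTopBand_of_weakCoupling`: the extensive gap of the `U = 0` reduced `d`-wave BCS torus,
`IsogapTransport.extensiveGap`, survives as `(κ − U)L²`; left chord), with an inexplicit threshold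
`U ≤ κ(δ,g₀)/2`. Here the threshold is made quantitative and the floor pushed down to `g_U = B/log(A/U) → 0`:
* `cooperTarget_explicitGap` — the free `d`-wave Cooper logarithm reaches the BCS target `1/(4c)` at the
  EXPLICIT buffer `D(c) = (s³/384)·exp(−8192π²/(s⁶c))`, `s = 3/10`, `0 < c ≤ 1/8` (`cooperLog_dWave_ge` read
  at a prescribed `D`); `extensiveGap_of_cooperTarget` / `extensiveGap_explicit` — the tree's `extensiveGap`
  argument (`exists_mu_of_target`, `gap_at_side`, `budget_arith`) with the buffer as a parameter, hence
  `D(c)²/2 · L² ≤ E_L(0,0) − E_L(0,c)` eventually in even `L`;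
* `twSeededRung_logFloor` — ABSOLUTE constants `U₀ < A`, `B > 0` such that for `δ ∈ [1/10,2/5]`,
  `U ∈ (0,U₀]`, `g ≥ B/log(A/U)`, eventually in even `L`, EVERY normalised sector ground state of `H_L(U,g)`
  has `(U log(A/U)/B)·L⁴ ≤ re⟨ψ,P_Lψ⟩` (at `g_U` the explicit gap is exactly `2U L²`, the repulsion costs
  `≤ U L²`, the left chord gives order `U/g_U`, order bounds are an up-set in `g`);
  `twSeededRung_logFloor_band` — the same in the shape of the route declaration, floor `K·U ↦ B/log(A/U)`.
So the only part of `TwSeededRung` that is not a theorem of the tree is the seed sliver `K·U ≤ g < B/log(A/U)`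
(seeds comparable with the bare repulsion: the `U = 0` condensation energy `~e^{−B/g}` is below the interaction's
a-priori cost `U L²`) — the regime the thermal cruxes stmt-…-1697/1698 at `β = e^{a/U}` address. Constants are the
tree's, unoptimised: `A = (s³/384)²/4`, `B = 16384π²/s⁶`, `U₀ = A e^{−8B}`.
Folklore: variational principle (Tasaki 2020 §2.2); positivity of the Hubbard repulsion (Lieb 1989); BCS trial
state and Cooper logarithm (Bardeen–Cooper–Schrieffer 1957; Leggett, *Quantum Liquids* 2006, §5.4).
-/

noncomputable section

namespace Summit.HubbardSuperconductivity.TwSeededRung.LogFloor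

open Matrix Filter Finset Real
open Literature.MathematicalPhysics.QuantumLattice Literature.Probability.LatticeModels
open Summit.HubbardSuperconductivity.TwTipContinuation.Negative
open Summit.HubbardSuperconductivity.TwTipContinuation.IsogapTransport
open scoped ComplexOrder

/-! ### The Cooper target at an explicit gap buffer -/

/-- **The `d`-wave Cooper logarithm reaches the BCS target `1/(4c)` at the explicit buffer
`D(c) = (s³/384)·e^{−8192π²/(s⁶c)}`, `s = 3/10`** (`0 < c ≤ 1/8`): eventually in even `L`, for all
`|μ| ≤ 4 − 2s²`, `1/(4c) ≤ L⁻² Σ_k ĝ_d(k)²/(2√((ε_L(k)−μ)² + D²ĝ_d(k)² + D⁴))`.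
(`cooperLog_dWave_ge` with `log(s²L/64) − log(6DL/s) = log(s³/(384D)) = 8192π²/(s⁶c)`.) [folklore] -/
theorem cooperTarget_explicitGap {c : ℝ} (hc : 0 < c) (hc8 : c ≤ 1 / 8) :
    ∃ L₁ : ℕ, ∀ (L : ℕ) [NeZero L], L₁ ≤ L → Even L → ∀ μ : ℝ, |μ| ≤ 4 - 2 * (3 / 10 : ℝ) ^ 2 →
      1 / (4 * c) ≤ ((L : ℝ) ^ 2)⁻¹ * ∑ k : TorusSite 2 L, dWaveGap k ^ 2 /
        (2 * Real.sqrt ((torusBand L k - μ) ^ 2 +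
          ((3 / 10 : ℝ) ^ 3 / 384 * Real.exp (-(8192 * π ^ 2 / ((3 / 10 : ℝ) ^ 6 * c)))) ^ 2 *
            dWaveGap k ^ 2 +
          ((3 / 10 : ℝ) ^ 3 / 384 * Real.exp (-(8192 * π ^ 2 / ((3 / 10 : ℝ) ^ 6 * c)))) ^ 4)) := by
  have _h8 := hc8
  set s : ℝ := 3 / 10 with hs
  have hs0 : (0 : ℝ) < s := by rw [hs]; norm_num
  have hs1 : s ≤ 1 := by rw [hs]; norm_num
  have hπ := Real.pi_pos
  set κ : ℝ := s ^ 6 / (32768 * π ^ 2) with hκ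
  have hκ0 : 0 < κ := by positivity
  set M : ℝ := 1 / (4 * c) with hM
  have hM0 : 0 < M := by positivity
  set D : ℝ := s ^ 3 / 384 * Real.exp (-(8192 * π ^ 2 / (s ^ 6 * c))) with hD
  have hMκ : 8192 * π ^ 2 / (s ^ 6 * c) = M / κ := by
    rw [hM, hκ]
    field_simp
    ring
  have hDalt : D = s ^ 3 / 384 * Real.exp (-(M / κ)) := by rw [hD, hMκ]
  have hD0 : 0 < D := by positivity
  have hexp1 : Real.exp (-(M / κ)) ≤ 1 := by
    rw [Real.exp_le_one_iff, neg_nonpos]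
    positivity
  have hD100 : D ≤ 1 / 100 := by
    have hs3 : s ^ 3 ≤ 1 := pow_le_one₀ hs0.le hs1
    calc D ≤ s ^ 3 / 384 * 1 := by rw [hDalt]; gcongr
      _ ≤ 1 / 100 := by nlinarith
  have hD1 : D ≤ 1 := hD100.trans (by norm_num)
  refine ⟨⌈max (400 / s ^ 2) (2 * s / (3 * D))⌉₊, fun L _ hL hE μ hμ => ?_⟩
  have hL' : max (400 / s ^ 2) (2 * s / (3 * D)) ≤ (L : ℝ) := Nat.ceil_le.mp hL
  have hL1 : 400 / s ^ 2 ≤ (L : ℝ) := (le_max_left _ _).trans hL'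
  have hL2 : 2 * s / (3 * D) ≤ (L : ℝ) := (le_max_right _ _).trans hL'
  have hDL : 2 * s ≤ 3 * D * L := by
    rw [div_le_iff₀ (by positivity)] at hL2; linarith
  have hs2 : 0 < s ^ 2 := by positivity
  have hsL : 400 ≤ s ^ 2 * L := by rwa [div_le_iff₀ hs2, mul_comm] at hL1
  have hLr : (0 : ℝ) < L := by nlinarith
  have key := cooperLog_dWave_ge hs0 hs1 hD0 hD1 hL1 hDL hE hμ
  refine le_trans ?_ key
  -- `log(s²L/64) − log(6DL/s) = log(s³/(384 D)) = M/κ`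
  have hlog : Real.log (s ^ 2 * L / 64) - Real.log (6 * D * L / s) = M / κ := by
    rw [← Real.log_div (by positivity) (by positivity)]
    have : s ^ 2 * (L : ℝ) / 64 / (6 * D * L / s) = Real.exp (M / κ) := by
      rw [hDalt, Real.exp_neg]
      field_simp
      norm_num
    rw [this, Real.log_exp]
  rw [hlog, ← hκ, hM]
  have : κ * (1 / (4 * c) / κ) = 1 / (4 * c) := by field_simp
  rw [this]

/-! ### The extensive gap from a Cooper target at a prescribed buffer -/

/-- **The extensive gap at the `U = 0` edge from a Cooper target at a prescribed buffer** `0 < D ≤ 1/100`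
meeting the target `1/(4c)` (`0 < c ≤ 1/8`) eventually in even `L`, uniformly in `|μ| ≤ 4 − 2(3/10)²`:
eventually in even `L`, `D²/2 · L² ≤ E_L(0,0) − E_L(0,c)` in the sector `(2⌊(1−δ)L²/2⌋, S^z = 0)` (the tree's
`extensiveGap` argument: `exists_mu_of_target`, `gap_at_side`, `budget_arith`). [folklore] -/
theorem extensiveGap_of_cooperTarget (δ : ℝ) (hδ : δ ∈ Set.Icc (1 / 10 : ℝ) (2 / 5)) {c D : ℝ}
    (hc : 0 < c) (hc8 : c ≤ 1 / 8) (hD : 0 < D) (hD100 : D ≤ 1 / 100) {L₁ : ℕ}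
    (hcoop : ∀ (L : ℕ) [NeZero L], L₁ ≤ L → Even L → ∀ μ : ℝ, |μ| ≤ 4 - 2 * (3 / 10 : ℝ) ^ 2 →
      1 / (4 * c) ≤ ((L : ℝ) ^ 2)⁻¹ * ∑ k : TorusSite 2 L, dWaveGap k ^ 2 /
        (2 * Real.sqrt ((torusBand L k - μ) ^ 2 + D ^ 2 * dWaveGap k ^ 2 + D ^ 4))) :
    ∃ L₀ : ℕ, ∀ (L : ℕ) [NeZero L], L₀ ≤ L → Even L →
      D ^ 2 / 2 * (L : ℝ) ^ 2 ≤
        (Matrix.minEnergyOn (hubbardTorus 2 L 1 0) (szSector (2 * ⌊(1 - δ) * (L : ℝ) ^ 2 / 2⌋₊) 0))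
          - (Matrix.minEnergyOn (hubbardTorus 2 L 1 0 - ((c / (L : ℝ) ^ 2 : ℝ) : ℂ) •
              ((pairField dWaveFormFactor L)ᴴ * pairField dWaveFormFactor L))
                (szSector (2 * ⌊(1 - δ) * (L : ℝ) ^ 2 / 2⌋₊) 0)) := by
  obtain ⟨hδ1, hδ2⟩ := hδ
  set Cd := (∑ e ∈ insert 0 unitSteps, ‖((dWaveFormFactor e / Real.sqrt 2 : ℝ) : ℂ)‖ * 2) ^ 2 with hCd
  have hCd0 : 0 ≤ Cd := by positivity
  set C₀ : ℝ := 8 + c * (Cd / 2 + 256) with hC₀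
  set B₂ : ℝ := 16 + c * Cd with hB₂
  set K : ℝ := B₂ / D ^ 2 + 1 with hK
  have hK1 : 1 ≤ K := by rw [hK]; exact le_add_of_nonneg_left (by positivity)
  have hK0 : 0 ≤ K := by linarith
  have hKB : B₂ / D ^ 2 ≤ K := by rw [hK]; linarith
  obtain ⟨L₂, htune⟩ := exists_mu_of_target hD hD100 (K := K) hK0
  set Λ₁ : ℝ := (38 / 5) * K + C₀ * (3 / 4 + K ^ 2) with hΛ₁
  refine ⟨max L₁ (max L₂ (max 3 ⌈4 * Λ₁ / D ^ 2⌉₊)), fun L _ hL hE => ?_⟩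
  have hL₁ : L₁ ≤ L := (le_max_left _ _).trans hL
  have hL₂ : L₂ ≤ L := ((le_max_left _ _).trans (le_max_right _ _)).trans hL
  have hL3 : 3 ≤ L :=
    (((le_max_left _ _).trans (le_max_right _ _)).trans (le_max_right _ _)).trans hL
  have hLbig : 4 * Λ₁ / D ^ 2 ≤ (L : ℝ) :=
    (Nat.ceil_le.1 ((((le_max_right _ _).trans (le_max_right _ _)).trans (le_max_right _ _)).trans hL))
  have hLr : (0 : ℝ) < L := by exact_mod_cast (show 0 < L by omega)
  -- the sector and the target mean number
  set n : ℕ := ⌊(1 - δ) * (L : ℝ) ^ 2 / 2⌋₊ with hn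
  have hx0 : 0 ≤ (1 - δ) * (L : ℝ) ^ 2 / 2 := by
    have : 0 ≤ 1 - δ := by linarith
    positivity
  have hnle : (n : ℝ) ≤ (1 - δ) * (L : ℝ) ^ 2 / 2 := Nat.floor_le hx0
  have hnge : (1 - δ) * (L : ℝ) ^ 2 / 2 < n + 1 := Nat.lt_floor_add_one _
  have hn2 : 2 * (n : ℝ) ≤ (L : ℝ) ^ 2 := by nlinarith
  set t : ℝ := 2 * n - 2 * K * L with ht
  have ht1 : 3 / 5 * (L : ℝ) ^ 2 - 2 * K * L - 2 ≤ t := by rw [ht]; nlinarith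
  have ht2 : t ≤ 9 / 10 * (L : ℝ) ^ 2 := by
    rw [ht]
    have : 0 ≤ 2 * K * (L : ℝ) := by positivity
    nlinarith
  obtain ⟨μ, hμ, hocc⟩ := htune L hL₂ t ht1 ht2
  -- the Cooper bound at the tuned chemical potential
  have hμ' : |μ| ≤ 4 - 2 * (3 / 10 : ℝ) ^ 2 := hμ.trans (by norm_num)
  have hS := hcoop L hL₁ hE μ hμ'
  set S := ∑ k : TorusSite 2 L, dWaveGap k ^ 2 /
    (2 * Real.sqrt ((torusBand L k - μ) ^ 2 + D ^ 2 * dWaveGap k ^ 2 + D ^ 4)) with hSdef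
  have hL2pos : (0 : ℝ) < (L : ℝ) ^ 2 := by positivity
  rw [le_inv_mul_iff₀ hL2pos] at hS
  have hc4 : 2 ≤ 1 / (4 * c) := by
    rw [le_div_iff₀ (by positivity)]; linarith
  have hS1 : 2 * (L : ℝ) ^ 2 ≤ S :=
    le_trans (by nlinarith) hS
  have hS2 : (L : ℝ) ^ 2 ≤ 4 * c * S := by
    have h : (L : ℝ) ^ 2 * (1 / (4 * c)) ≤ S := hS
    rw [show (L : ℝ) ^ 2 * (1 / (4 * c)) = (L : ℝ) ^ 2 / (4 * c) by ring,
      div_le_iff₀ (by positivity)] at h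
    linarith
  -- the side estimate
  have hgt : ∑ k : TorusSite 2 L, (1 - (torusBand L k - μ) /
      Real.sqrt ((torusBand L k - μ) ^ 2 + D ^ 2 * dWaveGap k ^ 2 + D ^ 4)) < 2 * n := by
    rw [hocc, ht]
    have : 0 < 2 * K * (L : ℝ) := by positivity
    linarith
  have hside := gap_at_side hL3 hc hD hn2 hS1 hS2 hgt
  rw [hocc] at hside
  have hg : 2 * (n : ℝ) - t = 2 * K * L := by rw [ht]; ring
  have hbud := budget_arith (C₀ := C₀) (B₂ := B₂) hD hLr hK1 hKB hμ hg
    (by rw [hΛ₁] at hLbig; exact hLbig)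
  rw [← hCd, ← hC₀, ← hB₂] at hside
  linarith

/-- **The extensive gap at the `U = 0` edge, explicit constant**: for `δ ∈ [1/10, 2/5]`, `0 < c ≤ 1/8`,
eventually in even `L`, `D(c)²/2 · L² ≤ E_L(0,0) − E_L(0,c)` in the sector `(2⌊(1−δ)L²/2⌋, S^z = 0)`,
`D(c) = (s³/384)·e^{−8192π²/(s⁶c)}`, `s = 3/10` (the buffer of `cooperTarget_explicitGap`). [folklore] -/
theorem extensiveGap_explicit (δ : ℝ) (hδ : δ ∈ Set.Icc (1 / 10 : ℝ) (2 / 5)) {c : ℝ} (hc : 0 < c)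
    (hc8 : c ≤ 1 / 8) :
    ∃ L₀ : ℕ, ∀ (L : ℕ) [NeZero L], L₀ ≤ L → Even L →
      ((3 / 10 : ℝ) ^ 3 / 384 * Real.exp (-(8192 * π ^ 2 / ((3 / 10 : ℝ) ^ 6 * c)))) ^ 2 / 2 *
          (L : ℝ) ^ 2 ≤
        (Matrix.minEnergyOn (hubbardTorus 2 L 1 0) (szSector (2 * ⌊(1 - δ) * (L : ℝ) ^ 2 / 2⌋₊) 0))
          - (Matrix.minEnergyOn (hubbardTorus 2 L 1 0 - ((c / (L : ℝ) ^ 2 : ℝ) : ℂ) •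
              ((pairField dWaveFormFactor L)ᴴ * pairField dWaveFormFactor L))
                (szSector (2 * ⌊(1 - δ) * (L : ℝ) ^ 2 / 2⌋₊) 0)) := by
  obtain ⟨L₁, hcoop⟩ := cooperTarget_explicitGap hc hc8
  have hD : 0 < (3 / 10 : ℝ) ^ 3 / 384 * Real.exp (-(8192 * π ^ 2 / ((3 / 10 : ℝ) ^ 6 * c))) := by
    positivity
  have hD100 : (3 / 10 : ℝ) ^ 3 / 384 * Real.exp (-(8192 * π ^ 2 / ((3 / 10 : ℝ) ^ 6 * c))) ≤ 1 / 100 := by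
    have hexp1 : Real.exp (-(8192 * π ^ 2 / ((3 / 10 : ℝ) ^ 6 * c))) ≤ 1 := by
      rw [Real.exp_le_one_iff, neg_nonpos]
      positivity
    calc (3 / 10 : ℝ) ^ 3 / 384 * Real.exp (-(8192 * π ^ 2 / ((3 / 10 : ℝ) ^ 6 * c)))
        ≤ (3 / 10 : ℝ) ^ 3 / 384 * 1 := by gcongr
      _ ≤ 1 / 100 := by norm_num
  exact extensiveGap_of_cooperTarget δ hδ hc hc8 hD hD100 hcoop

/-! ### The interaction sandwich (private copies of `AnchorDischarge.gap_free_sub_le_gap` and its halves) -/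

section Interaction

variable {Λ : Type*} [LinearOrder Λ] [Fintype Λ]

/-- `0 ≤ re⟨ψ, Σ_x n_{x↑}n_{x↓} ψ⟩ ≤ |Λ| · re⟨ψ,ψ⟩` (`posSemidef_sum_numberOp_mul_numberOp`,
`posSemidef_card_sub_sum_numberOp_mul_numberOp`). Lieb, PRL 62 (1989) 1201. [folklore] -/
private theorem lf_re_expect_doubleOccupancy_mem (ψ : Fock (Orb Λ)) :
    0 ≤ (star ψ ⬝ᵥ (∑ x : Λ, numberOp x 0 * numberOp x 1 :
      Matrix (Finset (Orb Λ)) (Finset (Orb Λ)) ℂ) *ᵥ ψ).re ∧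
    (star ψ ⬝ᵥ (∑ x : Λ, numberOp x 0 * numberOp x 1 :
      Matrix (Finset (Orb Λ)) (Finset (Orb Λ)) ℂ) *ᵥ ψ).re ≤
      (Fintype.card Λ : ℝ) * (star ψ ⬝ᵥ ψ).re := by
  constructor
  · have h := (posSemidef_sum_numberOp_mul_numberOp (Λ := Λ)).dotProduct_mulVec_nonneg ψ
    exact (Complex.nonneg_iff.1 h).1
  · have h := (posSemidef_card_sub_sum_numberOp_mul_numberOp (Λ := Λ)).dotProduct_mulVec_nonneg ψ
    rw [sub_mulVec, smul_mulVec, one_mulVec, dotProduct_sub, dotProduct_smul] at h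
    have h' := (Complex.nonneg_iff.1 h).1
    rw [Complex.sub_re] at h'
    have hre : (((Fintype.card Λ : ℕ) : ℂ) • (star ψ ⬝ᵥ ψ)).re = (Fintype.card Λ : ℝ) * (star ψ ⬝ᵥ ψ).re := by
      rw [smul_eq_mul, ← Complex.ofReal_natCast, Complex.re_ofReal_mul]
    linarith [hre]

end Interaction

section Sandwich

variable (U g : ℝ) (L : ℕ) [NeZero L]

/-- `H_L(U,g) = H_L(0,g) + U Σ_x n_{x↑}n_{x↓}` (`hamiltonianWith_sub_hamiltonianWith` at `μ = 0`).
Lieb, PRL 62 (1989) 1201. [folklore] -/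
private theorem lf_seededH_eq_free_add_interaction :
    hubbardTorus 2 L 1 U - ((g / (L : ℝ) ^ 2 : ℝ) : ℂ) • ((pairField dWaveFormFactor L)ᴴ * pairField dWaveFormFactor L) =
      (hubbardTorus 2 L 1 0 - ((g / (L : ℝ) ^ 2 : ℝ) : ℂ) • ((pairField dWaveFormFactor L)ᴴ * pairField dWaveFormFactor L)) +
        (U : ℂ) • (∑ x : FermionTorus 2 L, numberOp x 0 * numberOp x 1 :
          Matrix (Finset (Orb (FermionTorus 2 L))) (Finset (Orb (FermionTorus 2 L))) ℂ) := by
  have h := hamiltonianWith_sub_hamiltonianWith (fermionTorusGraph 2 L) 1 0 U 0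
  simp only [hamiltonianWith_zero, sub_zero] at h
  have h' : hubbardTorus 2 L 1 U = hubbardTorus 2 L 1 0 +
      (U : ℂ) • (∑ x : FermionTorus 2 L, numberOp x 0 * numberOp x 1 :
        Matrix (Finset (Orb (FermionTorus 2 L))) (Finset (Orb (FermionTorus 2 L))) ℂ) := by
    unfold hubbardTorus
    rw [← h]
    abel
  rw [h']
  abel

/-- `re⟨ψ, H_L(U,g) ψ⟩ = re⟨ψ, H_L(0,g) ψ⟩ + U · re⟨ψ, Σ_x n_{x↑}n_{x↓} ψ⟩`. [folklore] -/
private theorem lf_re_expect_seededH_eq_free_add (ψ : Fock (Orb (FermionTorus 2 L))) :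
    (expect (hubbardTorus 2 L 1 U - ((g / (L : ℝ) ^ 2 : ℝ) : ℂ) • ((pairField dWaveFormFactor L)ᴴ * pairField dWaveFormFactor L)) ψ).re =
      (expect (hubbardTorus 2 L 1 0 - ((g / (L : ℝ) ^ 2 : ℝ) : ℂ) • ((pairField dWaveFormFactor L)ᴴ * pairField dWaveFormFactor L)) ψ).re +
        U * (star ψ ⬝ᵥ (∑ x : FermionTorus 2 L, numberOp x 0 * numberOp x 1 :
          Matrix (Finset (Orb (FermionTorus 2 L))) (Finset (Orb (FermionTorus 2 L))) ℂ) *ᵥ ψ).re := by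
  unfold Literature.MathematicalPhysics.QuantumLattice.expect
  rw [lf_seededH_eq_free_add_interaction U g L, add_mulVec, smul_mulVec, dotProduct_add, dotProduct_smul,
    smul_eq_mul, Complex.add_re, Complex.re_ofReal_mul]

/-- **The seed's energy gain is `U`-robust up to `U L²`**:
`E_L(0,0) − E_L(0,c) − U L² ≤ E_L(U,0) − E_L(U,c)` for `U ≥ 0` (repulsion raises every seeded
sector energy, and by at most `U L²`; variational principle at normalised sector ground states).
Tasaki (2020) §2.2. [folklore] -/
private theorem lf_gap_free_sub_le_gap (hU : 0 ≤ U) {n : ℕ} (hn : n ≤ Fintype.card (FermionTorus 2 L)) (c : ℝ) :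
    (Matrix.minEnergyOn (hubbardTorus 2 L 1 0) (szSector (2 * n) 0))
        - (Matrix.minEnergyOn (hubbardTorus 2 L 1 0 - ((c / (L : ℝ) ^ 2 : ℝ) : ℂ) • ((pairField dWaveFormFactor L)ᴴ * pairField dWaveFormFactor L)) (szSector (2 * n) 0))
        - U * (L : ℝ) ^ 2 ≤
      (Matrix.minEnergyOn (hubbardTorus 2 L 1 U) (szSector (2 * n) 0))
        - (Matrix.minEnergyOn (hubbardTorus 2 L 1 U - ((c / (L : ℝ) ^ 2 : ℝ) : ℂ) • ((pairField dWaveFormFactor L)ᴴ * pairField dWaveFormFactor L)) (szSector (2 * n) 0)) := by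
  -- lower half at seed `0`: test `H_L(0,0)` on a normalised sector ground state of `H_L(U,0)`
  have h1 : (Matrix.minEnergyOn (hubbardTorus 2 L 1 0 - ((0 / (L : ℝ) ^ 2 : ℝ) : ℂ) • ((pairField dWaveFormFactor L)ᴴ * pairField dWaveFormFactor L)) (szSector (2 * n) 0)) ≤
      (Matrix.minEnergyOn (hubbardTorus 2 L 1 U - ((0 / (L : ℝ) ^ 2 : ℝ) : ℂ) • ((pairField dWaveFormFactor L)ᴴ * pairField dWaveFormFactor L)) (szSector (2 * n) 0)) := by
    obtain ⟨ψ, hψ, hgs⟩ := exists_unit_groundState U 0 L hn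
    have hvar := (seeded_sector_groundState 0 0 L hn).2 ψ hgs.1 hψ
    have heq := expect_eq_of_groundState L hψ hgs
    have hsplit := lf_re_expect_seededH_eq_free_add U 0 L ψ
    have hD := (lf_re_expect_doubleOccupancy_mem ψ).1
    rw [heq, Complex.ofReal_re] at hsplit
    nlinarith [mul_nonneg hU hD]
  -- upper half at seed `c`: test `H_L(U,c)` on a normalised sector ground state of `H_L(0,c)`
  have h2 : (Matrix.minEnergyOn (hubbardTorus 2 L 1 U - ((c / (L : ℝ) ^ 2 : ℝ) : ℂ) • ((pairField dWaveFormFactor L)ᴴ * pairField dWaveFormFactor L)) (szSector (2 * n) 0)) ≤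
      (Matrix.minEnergyOn (hubbardTorus 2 L 1 0 - ((c / (L : ℝ) ^ 2 : ℝ) : ℂ) • ((pairField dWaveFormFactor L)ᴴ * pairField dWaveFormFactor L)) (szSector (2 * n) 0)) +
        U * (L : ℝ) ^ 2 := by
    obtain ⟨φ, hφ, hgs⟩ := exists_unit_groundState 0 c L hn
    have hvar := (seeded_sector_groundState U c L hn).2 φ hgs.1 hφ
    have heq := expect_eq_of_groundState L hφ hgs
    have hsplit := lf_re_expect_seededH_eq_free_add U c L φ
    have hD := (lf_re_expect_doubleOccupancy_mem φ).2
    rw [Summit.HubbardSuperconductivity.NoGo.card_fermionTorus_two, hφ, Complex.one_re, mul_one] at hD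
    push_cast at hD
    rw [heq, Complex.ofReal_re] at hsplit
    nlinarith [mul_le_mul_of_nonneg_left hD hU]
  rw [seededH_zero, seededH_zero] at h1
  linarith

end Sandwich

/-! ### The anchor down to logarithmic seeds -/

/-- **Every-ground-state `d`-wave order of the weakly repulsive seeded torus down to seeds `g ≥ B/log(A/U)`.**
Absolute constants `0 < U₀ < A`, `0 < B`: for `δ ∈ [1/10,2/5]`, `U ∈ (0,U₀]`, `g ≥ B/log(A/U)`, eventually in
even `L`, EVERY normalised ground state `ψ` of `hubbardTorus 2 L 1 U − (g/L²)(pairField d L)ᴴ(pairField d L)` in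
the sector `(2⌊(1−δ)L²/2⌋, S^z=0)` has `c L⁴ ≤ re⟨ψ,(pairField d L)ᴴ(pairField d L)ψ⟩`, `c = U log(A/U)/B`. Proof: at
`g_U := B/log(A/U) ≤ 1/8` the gap of `extensiveGap_explicit` is exactly `2U L²`, the repulsion costs `≤ U L²`
(sandwich), the left chord `leftChord_le_order` gives order `U/g_U`, and `everyGSOrder_mono` lifts it to `g ≥ g_U`.
`A = (s³/384)²/4`, `B = 16384π²/s⁶`, `s = 3/10`, `U₀ = A e^{−8B}`. [folklore] -/
theorem twSeededRung_logFloor :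
    ∃ U₀ A B : ℝ, 0 < U₀ ∧ U₀ < A ∧ 0 < B ∧ ∀ δ ∈ Set.Icc (1 / 10 : ℝ) (2 / 5),
      ∀ U ∈ Set.Ioc (0 : ℝ) U₀, ∀ g : ℝ, B / Real.log (A / U) ≤ g →
        ∃ c : ℝ, 0 < c ∧ ∃ L₀ : ℕ, ∀ (L : ℕ) [NeZero L], L₀ ≤ L → Even L →
          ∀ ψ : Fock (Orb (FermionTorus 2 L)), star ψ ⬝ᵥ ψ = 1 →
            IsGroundStateInSector (hubbardTorus 2 L 1 U - ((g / (L : ℝ) ^ 2 : ℝ) : ℂ) •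
              ((pairField dWaveFormFactor L)ᴴ * pairField dWaveFormFactor L))
                (2 * ⌊(1 - δ) * (L : ℝ) ^ 2 / 2⌋₊) 0 ψ →
              c * (L : ℝ) ^ 4 ≤
                (expect ((pairField dWaveFormFactor L)ᴴ * pairField dWaveFormFactor L) ψ).re := by
  have hπ := Real.pi_pos
  set A : ℝ := ((3 / 10 : ℝ) ^ 3 / 384) ^ 2 / 4 with hA
  set B : ℝ := 16384 * π ^ 2 / (3 / 10 : ℝ) ^ 6 with hB
  have hA0 : 0 < A := by positivity
  have hB0 : 0 < B := by positivity
  have hU₀A : A * Real.exp (-(8 * B)) < A := by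
    have h1 : Real.exp (-(8 * B)) < 1 := Real.exp_lt_one_iff.mpr (by linarith)
    calc A * Real.exp (-(8 * B)) < A * 1 := mul_lt_mul_of_pos_left h1 hA0
      _ = A := mul_one A
  refine ⟨A * Real.exp (-(8 * B)), A, B, by positivity, hU₀A, hB0, ?_⟩
  intro δ hδ U hU g hg
  obtain ⟨hU0, hUle⟩ := hU
  -- `log (A/U) ≥ 8B > 0`
  have hlog : 8 * B ≤ Real.log (A / U) := by
    rw [Real.le_log_iff_exp_le (by positivity), le_div_iff₀ hU0]
    calc Real.exp (8 * B) * U ≤ Real.exp (8 * B) * (A * Real.exp (-(8 * B))) :=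
          mul_le_mul_of_nonneg_left hUle (Real.exp_pos _).le
      _ = A := by rw [Real.exp_neg]; field_simp
  have hlog0 : 0 < Real.log (A / U) := lt_of_lt_of_le (by positivity) hlog
  set g₁ : ℝ := B / Real.log (A / U) with hg₁
  have hg₁0 : 0 < g₁ := div_pos hB0 hlog0
  have hg₁8 : g₁ ≤ 1 / 8 := by
    rw [hg₁, div_le_iff₀ hlog0]; linarith
  -- order at the floor `g₁`, then every `g ≥ g₁`
  refine everyGSOrder_mono hg ?_
  obtain ⟨L₀, hgap⟩ := extensiveGap_explicit δ hδ hg₁0 hg₁8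
  -- the explicit gap constant at `g₁` is exactly `2U`
  have h2x : -(8192 * π ^ 2 / ((3 / 10 : ℝ) ^ 6 * g₁)) + -(8192 * π ^ 2 / ((3 / 10 : ℝ) ^ 6 * g₁)) =
      -Real.log (A / U) := by
    have h1 : 2 * (8192 * π ^ 2 / ((3 / 10 : ℝ) ^ 6 * g₁)) = Real.log (A / U) := by
      rw [hg₁, hB]
      field_simp
      ring
    linarith
  have hκ : ((3 / 10 : ℝ) ^ 3 / 384 * Real.exp (-(8192 * π ^ 2 / ((3 / 10 : ℝ) ^ 6 * g₁)))) ^ 2 / 2 =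
      2 * U := by
    rw [mul_pow, sq (Real.exp _), ← Real.exp_add, h2x, Real.exp_neg, Real.exp_log (div_pos hA0 hU0),
      inv_div, hA]
    field_simp
    ring
  refine ⟨U / g₁, div_pos hU0 hg₁0, L₀, fun L _ hL hE ψ hψ hgs => ?_⟩
  have hn := le_card_of_mem_szSector L hgs.1 hgs.2.1
  have hg' := hgap L hL hE
  rw [hκ] at hg'
  have ht := lf_gap_free_sub_le_gap U L hU0.le hn g₁
  have hchord := leftChord_le_order (U := U) (g := g₁) (g' := 0) hg₁0 hψ hgs
  rw [seededH_zero, sub_zero] at hchord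
  have hL2 : (0 : ℝ) < (L : ℝ) ^ 2 := by
    have := NeZero.pos L
    positivity
  set X := (expect ((pairField dWaveFormFactor L)ᴴ * pairField dWaveFormFactor L) ψ).re with hX
  have key : U * (L : ℝ) ^ 2 ≤ g₁ / (L : ℝ) ^ 2 * X := by linarith
  rw [div_mul_eq_mul_div, le_div_iff₀ hL2] at key
  rw [div_mul_eq_mul_div, div_le_iff₀ hg₁0]
  calc U * (L : ℝ) ^ 4 = U * (L : ℝ) ^ 2 * (L : ℝ) ^ 2 := by ring
    _ ≤ g₁ * X := key
    _ = X * g₁ := mul_comm _ _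

/-- **The anchor's band down to logarithmic seeds, in the shape of the route declaration** — `TwSeededRung`
with its seed floor `K·U` replaced by `B/log(A/U)` (`δ ∈ [1/10,2/5]`, `U ∈ (0,U₀]`, `g ∈ [B/log(A/U), 1/10]`,
every normalised `(2⌊(1−δ)L²/2⌋, S^z=0)`-sector ground state of `H_L(U,g)`, eventually in even `L`). [folklore] -/
theorem twSeededRung_logFloor_band :
    ∀ δ ∈ Set.Icc (1 / 10 : ℝ) (2 / 5), ∃ U₀ A B : ℝ, 0 < U₀ ∧ U₀ < A ∧ 0 < B ∧
      ∀ U ∈ Set.Ioc (0 : ℝ) U₀, ∀ g ∈ Set.Icc (B / Real.log (A / U)) (1 / 10 : ℝ),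
        ∃ c : ℝ, 0 < c ∧ ∃ L₀ : ℕ, ∀ (L : ℕ) [NeZero L], L₀ ≤ L → Even L →
          ∀ ψ : Fock (Orb (FermionTorus 2 L)), star ψ ⬝ᵥ ψ = 1 →
            IsGroundStateInSector (hubbardTorus 2 L 1 U - ((g / (L : ℝ) ^ 2 : ℝ) : ℂ) •
              ((pairField dWaveFormFactor L)ᴴ * pairField dWaveFormFactor L))
                (2 * ⌊(1 - δ) * (L : ℝ) ^ 2 / 2⌋₊) 0 ψ →
              c * (L : ℝ) ^ 4 ≤
                (expect ((pairField dWaveFormFactor L)ᴴ * pairField dWaveFormFactor L) ψ).re := by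
  obtain ⟨U₀, A, B, hU₀, hUA, hB, h⟩ := twSeededRung_logFloor
  exact fun δ hδ => ⟨U₀, A, B, hU₀, hUA, hB, fun U hU g hg => h δ hδ U hU g hg.1⟩

end Summit.HubbardSuperconductivity.TwSeededRung.LogFloor
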